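import Summits.Schanuel.Schanuel.Theorems.RigidCoreSchanuelOnLogFreeCoreSectorExactness
import Summits.Schanuel.Schanuel.Theorems.RigidCoreSchanuelOnLogFreeCoreConjugationOffAxes
import Summits.Schanuel.Schanuel.Theorems.RigidCoreSchanuelOnLogFreeCoreExceptionalSubspacesIntersect
import Summits.Schanuel.Schanuel.Theorems.RigidCoreSchanuelOnLogFreeCoreCoreRelCalibration
import Summits.Schanuel.Schanuel.Theses.SingularModulusScaling

/-!
# Sibling audit for crux stmt-Schanuel-9545 `PiFreeOverLWField` (suspect = equivalence)

Kernel facts about every PROVED sibling of item 9545 (routes ExceptionalSubspaces /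
GaussianStokesSector / SingularModulusScaling) and about the equivalence witness
`schanuel_iff_piFree_and_relSchanuel`:
* `#print axioms` pinned by `#guard_msgs` (any `sorryAx` or extra axiom is an error);
* hypothesis usage (`#hyp_usage`, a custom elaborator — not allowed through the gate) was run in the
  planner folder copy `audit/SiblingAxioms.lean` (attached as item evidence with its output): every
  Prop binder of every closing theorem below is `used=true`; only the two dead binders
  (CMBoundedDegreeFreeness, ExpLogBoundedDegree) of `SingularModulusScaling.closes` are `used=false`.
-/

namespace SiblingAudit
open Summit.Schanuel.Schanuel.Theorems.RigidCore
open Summit.Schanuel.Schanuel.Theses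

/-! ## 1. The equivalence witness and the two proved glue items (9556 Exactness, 9557 Assembly) -/

/-- info: 'Summit.Schanuel.Schanuel.Theorems.RigidCore.SectorExactness.schanuel_iff_piFree_and_relSchanuel' depends on axioms: [propext, Classical.choice, Quot.sound] -/
#guard_msgs (whitespace := lax) in
#print axioms SectorExactness.schanuel_iff_piFree_and_relSchanuel

/-- info: 'Summit.Schanuel.Schanuel.Theorems.RigidCore.stub_exactness' depends on axioms: [propext, Classical.choice, Quot.sound] -/
#guard_msgs (whitespace := lax) in
#print axioms stub_exactness

/-- info: 'Summit.Schanuel.Schanuel.Theorems.RigidCore.SectorGlue.gaussianStokesSector_assembly' depends on axioms: [propext, Classical.choice, Quot.sound] -/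
#guard_msgs (whitespace := lax) in
#print axioms SectorGlue.gaussianStokesSector_assembly

/-- info: 'Summit.Schanuel.Schanuel.Theses.SingularModulusScaling.closes' depends on axioms: [propext, Classical.choice, Quot.sound] -/
#guard_msgs (whitespace := lax) in
#print axioms SingularModulusScaling.closes


/-! ## 2. The other proved siblings of 9545 (route ExceptionalSubspaces: 9550–9553, 9555) -/

/-- info: 'Summit.Schanuel.Schanuel.Theorems.RigidCore.stub_endomorphismCriterion' depends on axioms: [propext, Classical.choice, Quot.sound] -/
#guard_msgs (whitespace := lax) in
#print axioms stub_endomorphismCriterion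

/-- info: 'Summit.Schanuel.Schanuel.Theorems.RigidCore.stub_conjugationOffAxes' depends on axioms: [propext, Classical.choice, Quot.sound] -/
#guard_msgs (whitespace := lax) in
#print axioms stub_conjugationOffAxes

/-- info: 'Summit.Schanuel.Schanuel.Theorems.RigidCore.stub_exceptionalLineDichotomy' depends on axioms: [propext, Classical.choice, Quot.sound] -/
#guard_msgs (whitespace := lax) in
#print axioms stub_exceptionalLineDichotomy

/-- info: 'Summit.Schanuel.Schanuel.Theorems.RigidCore.SubspaceIntersect.exceptionalSubspacesIntersect' depends on axioms: [propext, Classical.choice, Quot.sound] -/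
#guard_msgs (whitespace := lax) in
#print axioms SubspaceIntersect.exceptionalSubspacesIntersect

/-- info: 'Summit.Schanuel.Schanuel.Theorems.RigidCore.EndoCriterion.dOneGlue' depends on axioms: [propext, Classical.choice, Quot.sound] -/
#guard_msgs (whitespace := lax) in
#print axioms EndoCriterion.dOneGlue


/-! ## 3. The decls are shared verbatim: the SingularModulusScaling copies of 9545 / 9548 / Assembly
are definitionally the GaussianStokesSector ones (so the witness applies to this route's decls). -/
example : SingularModulusScaling.PiFreeOverLWField ↔ GaussianStokesSector.PiFreeOverLWField := Iff.rfl
example : SingularModulusScaling.RelSchanuelOverPiLWField ↔ GaussianStokesSector.RelSchanuelOverPiLWField := Iff.rfl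
example : _root_.Schanuel ↔
    SingularModulusScaling.PiFreeOverLWField ∧ SingularModulusScaling.RelSchanuelOverPiLWField :=
  SectorExactness.schanuel_iff_piFree_and_relSchanuel


/-! ## 4. Content certificates: each conjunct of the split ALONE contains a printed open problem
(so neither is insubstantial), by landed theorems composed by name. -/

/-- 9545 alone ⟹ `e ⊥ π` (periods.S15 `ExpOnePiAlgebraicIndependent`, printed OPEN). -/
example (h : SingularModulusScaling.PiFreeOverLWField) :
    Literature.NumberTheory.Transcendental.ExpOnePiAlgebraicIndependent :=
  KernelTower.expOnePi_of_piFreeOverLWField h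

/-- 9548 alone ⟹ `e^{π²}` and `e^e` are transcendental (both printed OPEN, Waldschmidt 2000 §1.4). -/
example (h : SingularModulusScaling.RelSchanuelOverPiLWField) :
    Transcendental ℚ (Complex.exp ((Real.pi : ℂ) ^ 2)) ∧
      Transcendental ℚ (Complex.exp (Complex.exp 1)) :=
  stub_coreRel_calibration (stub_coreRel_of_relSchanuel h)

/-- info: 'Summit.Schanuel.Schanuel.Theorems.RigidCore.KernelTower.expOnePi_of_piFreeOverLWField' depends on axioms: [propext, Classical.choice, Quot.sound] -/
#guard_msgs (whitespace := lax) in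
#print axioms KernelTower.expOnePi_of_piFreeOverLWField

/-- info: 'Summit.Schanuel.Schanuel.Theorems.RigidCore.stub_coreRel_calibration' depends on axioms: [propext, Classical.choice, Quot.sound] -/
#guard_msgs (whitespace := lax) in
#print axioms stub_coreRel_calibration

end SiblingAudit
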